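import Literature.NumberTheory.LFunctions.RHInvZetaBound
import Literature.Analysis.SpecialFunctions.GammaStirlingOrder
import Literature.NumberTheory.LFunctions.LapidusVanFrankenhuijsenVerticalProgressionsRefutation
import Literature.NumberTheory.LFunctions.ZetaClassicalRegionBounds
import HarnessLib

/-!
# Littlewood's theorem on the gaps between zero ordinates of `ζ` — inputs of the proof

Trunk T-ANT (`Literature/NumberTheory/LFunctions`).  First of three files PROVING the named fact
`Literature.NumberTheory.LFunctions.littlewood_zero_ordinate_gaps_shrink` (`LittlewoodZeroGaps.lean`; Titchmarsh,
*The Theory of the Riemann Zeta-Function*, 2nd ed., Thm 9.11 / Thm 9.12) by Titchmarsh's first proof of §9.12 (a chain of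
circles, Borel–Carathéodory + Hadamard's three circles) run with a FIXED width `δ`, which yields the qualitative statement
«every large `T` is within `δ` of a zero ordinate».  This file supplies the analytic inputs, with explicit constants:

* `log_norm_zeta_le` — `log ‖ζ(z)‖ ≤ 3 log(|Im z| + 4)` on `Re z ≥ −1`, `|Im z| ≥ 1`;
* `norm_log_zeta_le_two` — `‖log ζ(z)‖ ≤ 2` on `Re z ≥ 2` (principal branch);
* `log_norm_zeta_neg_half_ge` — `log T − 9 ≤ log ‖ζ(−1/2 + iT)‖` for `T ≥ 2` (functional equation + Stirling-type bounds);
* `norm_le_of_sphere_bound` (maximum modulus on a disc), `norm_le_of_re_le` (Borel–Carathéodory at radii `4h ↦ 3h`: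
  `‖L‖ ≤ 6A + 7‖L(c)‖`), `b_pos_lt_one` (`0 < 1 − log 2/log 3 < 1`).

The chain itself is `LittlewoodZeroGapsChain.lean`; the theorem is `LittlewoodZeroGapsProofs.lean`.  Sorry-free, standard
axioms; no instances, no notation.  Provenance: cell rh-split, seat rh-split-typer-2 g4 (discharge of cut (xiv-d) L0).
-/

noncomputable section

open Complex Metric Set Real Filter Topology

namespace Literature.NumberTheory.LFunctions

namespace LittlewoodZeroGaps

open Literature.NumberTheory.LFunctions.InvZetaRH (norm_riemannZeta_sub_one_le rho rho_lt_one rho_pos)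
open Literature.Analysis.SpecialFunctions (norm_Gamma_ge_exp abs_sinh_im_le_norm_cos
  exp_le_four_mul_sinh)

/-- Upper bound: `log ‖ζ(z)‖ ≤ 3 log(|Im z| + 4)` for `Re z ≥ -1`, `|Im z| ≥ 1` (Titchmarsh's «`R f(s) < A₁ log T` on all
the circles», from the polynomial bound `‖ζ‖ ≤ (|t|+4)³` on `σ ≥ −1`). [cite: Titchmarsh1986, §9.12] -/
theorem log_norm_zeta_le {z : ℂ} (hre : -1 ≤ z.re) (him : 1 ≤ |z.im|) :
    Real.log ‖riemannZeta z‖ ≤ 3 * Real.log (|z.im| + 4) := by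
  have h := norm_riemannZeta_le_cube_of_one_le_abs_im hre him
  have h4 : 0 < |z.im| + 4 := by positivity
  by_cases h0 : riemannZeta z = 0
  · rw [h0, norm_zero, Real.log_zero]
    exact mul_nonneg (by norm_num) (Real.log_nonneg (by linarith))
  · calc Real.log ‖riemannZeta z‖ ≤ Real.log ((|z.im| + 4) ^ 3) :=
          Real.log_le_log (norm_pos_iff.mpr h0) h
      _ = 3 * Real.log (|z.im| + 4) := by rw [Real.log_pow]; push_cast; ring

/-- `‖log w‖ ≤ 2` when `‖w − 1‖ ≤ ρ = π²/6 − 1` (principal branch). [folklore] -/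
private theorem norm_log_le_two_of_norm_sub_one_le {w : ℂ} (hw : ‖w - 1‖ ≤ rho) : ‖log w‖ ≤ 2 := by
  set z : ℂ := w - 1 with hz
  have hρ1 : rho < 1 := rho_lt_one
  have hρ : rho ≤ 13 / 20 := by
    have := Real.pi_lt_d4
    have h : rho = π ^ 2 / 6 - 1 := rfl
    rw [h]; nlinarith [Real.pi_pos]
  have hz1 : ‖z‖ < 1 := lt_of_le_of_lt hw hρ1
  have hw' : w = 1 + z := by rw [hz]; ring
  rw [hw']
  refine (norm_log_one_add_le hz1).trans ?_
  have h0 : 0 ≤ ‖z‖ := norm_nonneg _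
  have hz2 : ‖z‖ ≤ 13 / 20 := hw.trans hρ
  have h2 : (1 - ‖z‖)⁻¹ ≤ 3 := by
    rw [inv_le_comm₀ (by linarith) (by norm_num)]; linarith
  have h3 : 0 ≤ (1 - ‖z‖)⁻¹ := inv_nonneg.mpr (by linarith)
  have h1 : ‖z‖ ^ 2 ≤ 1 / 2 := by nlinarith
  nlinarith [mul_le_mul h1 h2 h3 (by norm_num : (0 : ℝ) ≤ 1 / 2)]

/-- On `Re z ≥ 2`: `‖log ζ z‖ ≤ 2` for the principal branch (Titchmarsh's «`|f(2+iT)| < A₂`», here on the whole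
half-plane `σ ≥ 2` since `‖ζ − 1‖ ≤ π²/6 − 1` there). [cite: Titchmarsh1986, §9.12] -/
theorem norm_log_zeta_le_two {z : ℂ} (hz : 2 ≤ z.re) : ‖log (riemannZeta z)‖ ≤ 2 :=
  norm_log_le_two_of_norm_sub_one_le (norm_riemannZeta_sub_one_le hz)

/-- **Polynomial growth of `ζ` on the line `Re s = −1/2`**: `log T − 9 ≤ log ‖ζ(−1/2 + iT)‖` for
`T ≥ 2`, from the functional equation `ζ(1−s) = 2(2π)^{−s}Γ(s)cos(πs/2)ζ(s)` at `s = 3/2 − iT`,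
`‖Γ(3/2 − iT)‖ = ‖1/2 − iT‖·‖Γ(1/2 − iT)‖ ≥ T·(2/15)e^{−πT/2}`, `‖cos‖ ≥ e^{πT/2}/4`,
`‖ζ(3/2 − iT)‖ ≥ 1/3` (Titchmarsh's «`|ζ(s)| > t^{A₅}` for `σ ≤ −1`», moved to the line `σ = −1/2` where the tree's
upper bound `‖ζ‖ ≤ (|t|+4)³` is also available). [cite: Titchmarsh1986, §9.12] -/
theorem log_norm_zeta_neg_half_ge {T : ℝ} (hT : 2 ≤ T) :
    Real.log T - 9 ≤ Real.log ‖riemannZeta (-1 / 2 + T * I)‖ := by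
  set s : ℂ := 3 / 2 - T * I with hs
  have hsre : s.re = 3 / 2 := by simp [hs]
  have hsim : s.im = -T := by simp [hs]
  have h1s : 1 - s = -1 / 2 + T * I := by rw [hs]; ring
  have hsn : ∀ n : ℕ, s ≠ -n := by
    intro n h
    have := congrArg Complex.re h
    rw [hsre] at this; simp at this; linarith [n.cast_nonneg (α := ℝ)]
  have hs1 : s ≠ 1 := by
    intro h; have := congrArg Complex.im h; rw [hsim] at this; simp at this; linarith
  have hfe := riemannZeta_one_sub hsn hs1
  rw [h1s] at hfe
  -- the pieces
  have hπ := Real.pi_gt_three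
  have hπ4 := Real.pi_lt_d2
  have hpow : ‖(2 * (π : ℂ)) ^ (-s)‖ = (2 * π) ^ (-(3 / 2 : ℝ)) := by
    rw [show (2 * (π : ℂ)) = ((2 * π : ℝ) : ℂ) by push_cast; ring,
      Complex.norm_cpow_eq_rpow_re_of_pos (by positivity), neg_re, hsre]
  have hpow_ge : (1 : ℝ) / 40 ≤ (2 * π) ^ (-(3 / 2 : ℝ)) := by
    have h1 : (2 * π) ^ (-(2 : ℝ)) ≤ (2 * π) ^ (-(3 / 2 : ℝ)) :=
      Real.rpow_le_rpow_of_exponent_le (by linarith) (by norm_num)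
    have h2 : (2 * π) ^ (-(2 : ℝ)) = ((2 * π) ^ 2)⁻¹ := by
      rw [Real.rpow_neg (by positivity), show (2 : ℝ) = ((2 : ℕ) : ℝ) by norm_num, Real.rpow_natCast]
    rw [h2] at h1
    have h3 : (1 : ℝ) / 40 ≤ ((2 * π) ^ 2)⁻¹ := by
      rw [one_div, inv_le_inv₀ (by positivity) (by positivity)]; nlinarith
    linarith
  have hG : T * (2 / 15 * Real.exp (-(π * T) / 2)) ≤ ‖Complex.Gamma s‖ := by
    have hs' : s = (1 / 2 - T * I) + 1 := by rw [hs]; ring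
    have hne : (1 / 2 : ℂ) - T * I ≠ 0 := by
      intro h; have := congrArg Complex.re h; simp at this
    rw [hs', Complex.Gamma_add_one _ hne, norm_mul]
    have hG0 := norm_Gamma_ge_exp (x := 1 / 2) (by norm_num) (by norm_num) (-T)
    have hcast : ((1 / 2 : ℝ) : ℂ) + ((-T : ℝ) : ℂ) * I = 1 / 2 - T * I := by push_cast; ring
    rw [hcast, abs_neg, abs_of_nonneg (by linarith)] at hG0
    have hn : T ≤ ‖(1 / 2 : ℂ) - T * I‖ := by
      have h := abs_im_le_norm ((1 / 2 : ℂ) - T * I)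
      have him : ((1 / 2 : ℂ) - T * I).im = -T := by simp
      rw [him, abs_neg, abs_of_nonneg (by linarith)] at h
      exact h
    exact mul_le_mul hn hG0 (by positivity) (norm_nonneg _)
  have hcos : Real.exp (π * T / 2) / 4 ≤ ‖Complex.cos (π * s / 2)‖ := by
    have h := abs_sinh_im_le_norm_cos (π * s / 2)
    have him : (π * s / 2 : ℂ).im = -(π * T / 2) := by simp [mul_im, div_ofNat_im, hsim]; ring
    rw [him, Real.sinh_neg, abs_neg, abs_of_nonneg (Real.sinh_nonneg_iff.2 (by positivity))] at h
    have hsinh := exp_le_four_mul_sinh (u := π * T / 2) (by nlinarith)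
    linarith
  have hζ : (1 : ℝ) / 3 ≤ ‖riemannZeta s‖ := by
    have h := ZetaClassicalRegion.norm_riemannZeta_ge_of_one_lt_re (s := s) (by rw [hsre]; norm_num)
    rw [hsre] at h; norm_num at h; exact h
  -- assemble
  have hE : Real.exp (-(π * T) / 2) * Real.exp (π * T / 2) = 1 := by
    rw [← Real.exp_add]; convert Real.exp_zero using 2; ring
  have key : 2 * (1 / 40) * (T * (2 / 15 * Real.exp (-(π * T) / 2))) *
      (Real.exp (π * T / 2) / 4) * (1 / 3) = T / 1800 := by
    have : 2 * (1 / 40) * (T * (2 / 15 * Real.exp (-(π * T) / 2))) *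
        (Real.exp (π * T / 2) / 4) * (1 / 3) =
        T / 1800 * (Real.exp (-(π * T) / 2) * Real.exp (π * T / 2)) := by ring
    rw [this, hE, mul_one]
  have hprod : T / 1800 ≤ ‖riemannZeta (-1 / 2 + T * I)‖ := by
    rw [hfe]
    simp only [norm_mul, Complex.norm_ofNat]
    rw [hpow]
    calc T / 1800 = 2 * (1 / 40) * (T * (2 / 15 * Real.exp (-(π * T) / 2))) *
          (Real.exp (π * T / 2) / 4) * (1 / 3) := key.symm
      _ ≤ 2 * (2 * π) ^ (-(3 / 2 : ℝ)) * ‖Complex.Gamma s‖ * ‖Complex.cos (π * s / 2)‖ *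
          ‖riemannZeta s‖ := by gcongr
  have hT0 : 0 < T := by linarith
  have hlog : Real.log 1800 ≤ 9 := by
    rw [Real.log_le_iff_le_exp (by norm_num)]
    have he := Real.exp_one_gt_d9
    have h9 : Real.exp 9 = (Real.exp 1) ^ 9 := by
      rw [show (9 : ℝ) = ((9 : ℕ) : ℝ) * 1 by norm_num, Real.exp_nat_mul]
    rw [h9]
    have hp : (2.7182818283 : ℝ) ^ 9 ≤ (Real.exp 1) ^ 9 := pow_le_pow_left₀ (by norm_num) he.le 9
    have hn : (1800 : ℝ) ≤ (2.7182818283 : ℝ) ^ 9 := by norm_num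
    exact hn.trans hp
  calc Real.log T - 9 ≤ Real.log T - Real.log 1800 := by linarith
    _ = Real.log (T / 1800) := by rw [Real.log_div hT0.ne' (by norm_num)]
    _ ≤ Real.log ‖riemannZeta (-1 / 2 + T * I)‖ := Real.log_le_log (by positivity) hprod

/-! ## The chain of circles (Titchmarsh §9.12, first proof, with fixed `δ`) -/

/-- Maximum modulus on a disc: a bound on the circle `‖z − c‖ = r` propagates to the closed disc,
for `L` holomorphic on a larger open disc (Titchmarsh's «since the circle `C_{ν−1}` includes the circle `c_ν`,
`m_ν ≤ M_{ν−1}`»). [cite: Titchmarsh1986, §9.12] -/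
theorem norm_le_of_sphere_bound {L : ℂ → ℂ} {c : ℂ} {r R B : ℝ} (hr : 0 < r) (hrR : r < R)
    (hL : DifferentiableOn ℂ L (ball c R)) (hB : ∀ z : ℂ, ‖z - c‖ = r → ‖L z‖ ≤ B)
    {z : ℂ} (hz : ‖z - c‖ ≤ r) : ‖L z‖ ≤ B := by
  have hcl : closure (ball c r) = closedBall c r := closure_ball c hr.ne'
  have hdc : DiffContOnCl ℂ L (ball c r) :=
    (hL.mono (by rw [hcl]; exact closedBall_subset_ball hrR)).diffContOnCl
  refine Complex.norm_le_of_forall_mem_frontier_norm_le isBounded_ball hdc ?_ ?_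
  · intro w hw
    rw [frontier_ball c hr.ne', mem_sphere, dist_eq_norm] at hw
    exact hB w hw
  · rw [hcl, mem_closedBall, dist_eq_norm]; exact hz

/-- **Borel–Carathéodory on the disc of radius `4h`, evaluated on `‖z − c‖ ≤ 3h`:**
`‖L z‖ ≤ 6A + 7‖L c‖` when `Re L ≤ A` (`A > 0`) on the disc (Titchmarsh's
«`𝐌_ν < ((δ + ¾δ)/(δ − ¾δ))(A₁ log T + |f(c_ν)|)`», radii rescaled `δ ↦ 4h`). [cite: Titchmarsh1986, §9.12] -/
theorem norm_le_of_re_le {L : ℂ → ℂ} {c : ℂ} {h A : ℝ} (hh : 0 < h) (hA : 0 < A)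
    (hL : DifferentiableOn ℂ L (ball c (4 * h))) (hre : ∀ z ∈ ball c (4 * h), (L z).re ≤ A)
    {z : ℂ} (hz : ‖z - c‖ ≤ 3 * h) : ‖L z‖ ≤ 6 * A + 7 * ‖L c‖ := by
  set f₀ : ℂ → ℂ := fun w ↦ L (c + w) with hf₀
  have hshift : ∀ w ∈ ball (0 : ℂ) (4 * h), c + w ∈ ball c (4 * h) := by
    intro w hw
    rw [mem_ball_zero_iff] at hw
    rwa [mem_ball, dist_eq_norm, add_sub_cancel_left]
  have hf₀d : DifferentiableOn ℂ f₀ (ball 0 (4 * h)) := by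
    intro w hw
    exact ((hL.differentiableAt (isOpen_ball.mem_nhds (hshift w hw))).comp w
      ((differentiableAt_const c).add differentiableAt_id)).differentiableWithinAt
  have hmaps : MapsTo f₀ (ball 0 (4 * h)) {w | w.re ≤ A} := fun w hw ↦ hre _ (hshift w hw)
  have hw : z - c ∈ ball (0 : ℂ) (4 * h) := by
    rw [mem_ball_zero_iff]; linarith
  have key := Complex.borelCaratheodory hA hf₀d hmaps (by positivity) hw
  have hf₀z : f₀ (z - c) = L z := by simp [hf₀]
  have hf₀0 : f₀ 0 = L c := by simp [hf₀]
  rw [hf₀z, hf₀0] at key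
  have hden : h ≤ 4 * h - ‖z - c‖ := by linarith
  have h1 : 2 * A * ‖z - c‖ / (4 * h - ‖z - c‖) ≤ 6 * A := by
    rw [div_le_iff₀ (by linarith)]
    nlinarith [norm_nonneg (z - c)]
  have h2 : ‖L c‖ * (4 * h + ‖z - c‖) / (4 * h - ‖z - c‖) ≤ 7 * ‖L c‖ := by
    rw [div_le_iff₀ (by linarith)]
    nlinarith [norm_nonneg (z - c), norm_nonneg (L c)]
  linarith

/-- The exponent `b = log(3/2)/log 3 = 1 − log 2/log 3 ∈ (0, 1)` of the three-circles step (Titchmarsh's `a`).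
[cite: Titchmarsh1986, §9.12] -/
theorem b_pos_lt_one : 0 < 1 - Real.log 2 / Real.log 3 ∧ 1 - Real.log 2 / Real.log 3 < 1 := by
  have h3 : 0 < Real.log 3 := Real.log_pos (by norm_num)
  have h2 : 0 < Real.log 2 := Real.log_pos (by norm_num)
  have h23 : Real.log 2 < Real.log 3 := Real.log_lt_log (by norm_num) (by norm_num)
  constructor
  · rw [sub_pos, div_lt_one h3]; exact h23
  · have : 0 < Real.log 2 / Real.log 3 := div_pos h2 h3
    linarith

end LittlewoodZeroGaps

end Literature.NumberTheory.LFunctions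

end
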